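import Summits.QuantumFields.YangMills.Theorems.PoincareLipschitzFlatOrganBelowThreshold
import Summits.QuantumFields.YangMills.Theorems.PoincareLipschitzFlatOrganLetters

/-!
# Line «poincare_lipschitz» on crux `HistoryTailL` (stmt-QuantumFields-19936) — K2 organ of record `hImproveCoreFlat` (RULING g9-8, text v1 bac8eda30a54887f):
# FILE K-6b «THE SUPPLIER'S DOOR: THE ORGAN FROM THE HALVING AT LARGE LEVELS ALONE»

Cell `ym3-torus` (YM ladder rung R3 = continuum SU(2) Yang–Mills on the three-torus — a RUNG, NOT the Clay problem: not `d = 4`, not infinite volume,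
not a mass gap); LEAD seat `ym-ust-19936-w1` gen 9.  THEOREMS ONLY (def-free); `--supports stmt-QuantumFields-19936`.

One screen of logic over two tree files: ★w7 g13's HALVING NORMAL FORM ✓`PoincareLipschitzFlatOrganLetters.flat_of_halving`
(`(∀ Λ > 0, ⟨halving at Λ⟩) → ⟨hImproveCoreFlat v1 VERBATIM⟩`) composed with this seat's K-6 ✓`PoincareLipschitzFlatOrganBelowThreshold.halving_of_large`
(the halving at every level follows from the halving at the levels `Λ ≥ Λ⋆`, `Λ⋆ > 0` the small-energy threshold of ★w5's log-free one-step) gives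
★★`hImproveCoreFlat_of_halving_large : ∃ Λ⋆ > 0, ((∀ Λ, Λ⋆ ≤ Λ → ⟨halving at Λ⟩) → ⟨hImproveCoreFlat v1 bac8eda30a54887f VERBATIM⟩)` —
THE SUPPLIER'S DOOR (RULING g9-10 amended): whoever proves the LARGE-normalised-energy halving «unit maps `ℤ³ → S³ ⊂ ℝ⁴`, flat `δ(ρ+1)`-almost-minimal
in every sub-box, `E(Q_R(z)) ≤ ΛR` with `Λ ≥ Λ⋆`, `R ≥ R₀(Λ)` ⇒ `E(Q_{2r}(z)) ≤ Λr` at one `r ∈ [R∕C₀(Λ), R∕4]`» (the Schoen–Uhlenbeck 1984 ∕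
Luckhaus 1988 content, not in print on `ℤ³`) closes the K2 organ, hence (✓K-5 ∘ ✓K-4b ∘ ✓K-3∕K-3c) `hRegH`, `BlockLipschitzL` and — with K1 and
`MeanDeviationL` — `HistoryTailL`.
HONEST: nothing here proves the halving at large levels, the organ, K1, `MeanDeviationL`, `BlockLipschitzL`, `HistoryTailL` or a summit statement.
[folklore] ([SchoenUhlenbeck1982] §2, §4).
-/

set_option autoImplicit false

noncomputable section

open scoped BigOperators InnerProductSpace
open Finset

namespace Summit.QuantumFields.YangMills.Theorems.PoincareLipschitzFlatOrganOfHalvingLarge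

open Literature.MathematicalPhysics.QuantumFieldTheory.Balaban1983to89
open B4Eq19LatticeOperators
open Summit.QuantumFields.YangMills.Theorems.PoincareLipschitzFlatOrganBelowThreshold (halving_of_large)
open Summit.QuantumFields.YangMills.Theorems.PoincareLipschitzFlatOrganLetters (flat_of_halving)

/-- ★★ THE SUPPLIER'S DOOR of the K2 organ: there is a threshold `Λ⋆ > 0` such that the HALVING instance of `hImproveCoreFlat` at the LARGE levels
`Λ ≥ Λ⋆` alone implies `hImproveCoreFlat` (LEAD w1 g9 FROZEN v1 = v0 bac8eda30a54887f, VERBATIM).  `flat_of_halving ∘ halving_of_large`.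
[folklore] [cite: SchoenUhlenbeck1982, §2, §4] -/
theorem hImproveCoreFlat_of_halving_large :
    ∃ Λs : ℝ, 0 < Λs ∧
    ((∀ Λ : ℝ, Λs ≤ Λ →
      ∃ (δ C₀ R₀ : ℝ), 0 < δ ∧ 1 ≤ C₀ ∧ 1 ≤ R₀ ∧
      ∀ (u : Zd 3 → EuclideanSpace ℝ (Fin 4)) (z : Zd 3) (R : ℤ),
        R₀ ≤ R →
        (∀ y, ‖u y‖ = 1) →
        (∀ (z' : Zd 3) (ρ : ℤ), 0 ≤ ρ → box z' (ρ + 1) ⊆ box z R →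
          ∀ v : Zd 3 → EuclideanSpace ℝ (Fin 4), (∀ y, y ∉ box z' ρ → v y = u y) → (∀ y ∈ box z' ρ, ‖v y‖ = 1) →
            ∑ y ∈ box z' (ρ + 1), ∑ μ : Fin 3, ‖u (y + unitVec μ) - u y‖ ^ 2 ≤
              (∑ y ∈ box z' (ρ + 1), ∑ μ : Fin 3, ‖v (y + unitVec μ) - v y‖ ^ 2) + δ * ((ρ : ℝ) + 1)) →
        (∑ y ∈ box z R, ∑ μ : Fin 3, ‖u (y + unitVec μ) - u y‖ ^ 2 ≤ Λ * R) →
        ∃ r : ℤ, 1 ≤ r ∧ (R : ℝ) ≤ C₀ * r ∧ 4 * r ≤ R ∧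
          ∑ y ∈ box z (2 * r), ∑ μ : Fin 3, ‖u (y + unitVec μ) - u y‖ ^ 2 ≤ Λ * r) →
    (∀ (Λ₀ ε₁ : ℝ), 0 < Λ₀ → 0 < ε₁ →
      ∃ (δ C₀ R₀ : ℝ), 0 < δ ∧ 1 ≤ C₀ ∧ 1 ≤ R₀ ∧
        ∀ (u : Zd 3 → EuclideanSpace ℝ (Fin 4)) (z : Zd 3) (R : ℤ),
          R₀ ≤ R →
          (∀ y, ‖u y‖ = 1) →
          (∀ (z' : Zd 3) (ρ : ℤ), 0 ≤ ρ → box z' (ρ + 1) ⊆ box z R →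
            ∀ v : Zd 3 → EuclideanSpace ℝ (Fin 4), (∀ y, y ∉ box z' ρ → v y = u y) → (∀ y ∈ box z' ρ, ‖v y‖ = 1) →
              ∑ y ∈ box z' (ρ + 1), ∑ μ : Fin 3, ‖u (y + unitVec μ) - u y‖ ^ 2 ≤
                (∑ y ∈ box z' (ρ + 1), ∑ μ : Fin 3, ‖v (y + unitVec μ) - v y‖ ^ 2) + δ * ((ρ : ℝ) + 1)) →
          (∑ y ∈ box z R, ∑ μ : Fin 3, ‖u (y + unitVec μ) - u y‖ ^ 2 ≤ Λ₀ * R) →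
          ∃ r : ℤ, 1 ≤ r ∧ (R : ℝ) ≤ C₀ * r ∧ 4 * r ≤ R ∧
            ∑ y ∈ box z (2 * r), ∑ μ : Fin 3, ‖u (y + unitVec μ) - u y‖ ^ 2 ≤ ε₁ * r)) := by
  obtain ⟨Λs, hΛs, hdoor⟩ := halving_of_large
  exact ⟨Λs, hΛs, fun hlarge => flat_of_halving (hdoor hlarge)⟩

end Summit.QuantumFields.YangMills.Theorems.PoincareLipschitzFlatOrganOfHalvingLarge

end
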